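import Summits.BirchSwinnertonDyer.Rank1Residual.Additive.CycLowerInputsBridge
import Summits.BirchSwinnertonDyer.Rank1Residual.Additive.XMultRankZeroCyclotomicPrimePrep
import Summits.BirchSwinnertonDyer.Rank1Residual.Additive.X4MThreeUpperHalfTowerFree
import Summits.BirchSwinnertonDyer.Rank1Residual.AdditivePotMult.RankZeroChiBranchPrimeFacts
import HarnessLib

/-!
# The potentially MULTIPLICATIVE locus (M), analytic rank `0`, `p ≡ 3 (mod 4)` (`p = 3` included): the
# LOWER half from a RATIONAL ODD `χ_p`-branch main conjecture for the multiplicative twist plus ONE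
# finite `μ`-certificate (cell `b2b-bsdres`, team n1011, seat n1011-p06, OWNERS row T-N10R, phase 3c)

HONEST FRAMING (cell `b2b-bsdres`, run/shared/lean/b2b/bsd-rank1-residual/, verbatim in every
file): the goal of the cell is to DELETE the COMBINATION-SHAPED residual classes of the
Birch–Swinnerton-Dyer formula for ALL analytic-rank `≤ 1` elliptic curves over `ℚ` — "full BSD
formula for every rank `≤ 1` curve in class `C`" assembled STRICTLY from published theorems — so
that the rank-`≤ 1` remainder becomes exactly the CONSTRUCTION-SHAPED classes, which are TYPED
(missing-input `Prop`s), NOT attempted. This is not "finishing BSD". Team n1011 (X4 ∧ `p = 3` / the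
additive block, §I items N10 / N11): research routes; prove what is provable now; no claim beyond
the stated classes; X4(M) / X4♯(G-ord) stay CONSTRUCTION-SHAPED; labels / census / located gap
UNCHANGED; nothing is booked. One definition + one `abbrev` (typed input / certificate shape, nothing asserted) and
theorems; no new named fact.

## What and why

Odd twin of `PotMultRatMainConjLowerBound.lean`: on (M) at `p ≡ 3 (mod 4)` the additive curve is
`E = E♭ ⊗ χ_{−p}`, `E♭` MULTIPLICATIVE at `p`, and the relevant `p`-adic `L`-series is the ODD branch of
the one-term measure on the MINUS symbols, `padicLFunctionMinusBranchMult f♭ a_p (p/2)` (constant term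
`a_p⁻¹ ∑ (a/p)[a/p]⁻_{f♭}`, tree theorem `constantCoeff_padicLFunctionMinusBranchMult_half`), Néron
normalisation `ϖ⁻ · |Ω⁻(E♭)| = Ω⁻_{f♭}`. At `p = 3` this is the (M)@3 share of N11 (82 103 of the
192 277 surj(3) sweep pairs of record — RESIDUAL-MAP §I, not re-derived here).

* §1 TYPED: `ChiBranchRatCharEqMultOddAt W p`; certificate shape `MultOddBranchUnitCoeffCert W p`.
* §2 KERNEL: `cycLowerLeadingTermAt_of_chiBranchRatCharEqMultOdd_of_unitCoeff` — rational odd branch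
  main conjecture + ONE unit coefficient ⟹ `CycLowerLeadingTermAt W p` (`k ≥ 0`; MTT §I.14 minus; odd
  Birch + Pal `entireLFunction_one_eq_of_twist_neg`, PROVED Pal `d < 0`; unit `|u(C)|·c_∞`).
* §3 CONSEQUENCES on X4(M), `r_an = 0`: `MissingLowerBoundAt W p` (p18's exact-(M) consumer, `hDelX`;
  every `p ≡ 3 (mod 4)`, `3` included) and `BSD(E,p)` on X4(M) ∧ surj(p) with additive-p1's printed upper
  half — at `p = 3` the TOWER-FREE form `ClassX4M.bsdp_three_rankZero_of_surj_of_lower'` (Kato minus-eigen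
  divisibility at `3`).

Located gap: as in the even file. X4(M) stays CONSTRUCTION-SHAPED; nothing booked.

References: Burungale–Castella–Skinner, IMRN 2025 Thm. 1.1.2 (a) [BurungaleCastellaSkinner2025];
Mazur–Tate–Teitelbaum, Invent. Math. 84 (1986) §I.8, §I.10, §I.13–I.14 [MazurTateTeitelbaum1986Invent];
Pal, Proc. AMS (2012) Thm. 3.2 [Pal2012]; Delbourgo, Compositio Math. 113 (1998) Prop. 4, §2.2 Lemma
(ii) [Delbourgo1998]; Kato, Astérisque 295 (2004) Thm. 17.4 [Kato2004Asterisque]; Wuthrich, Doc. Math.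
19 (2014) Lemma 20 [Wuthrich2014]; Miller, LMS J. Comput. Math. 14 (2011) Def. 1.1 [Miller2011LMS].
-/

noncomputable section

open scoped Classical MatrixGroups ModularForm NumberField

open CongruenceSubgroup WeierstrassCurve NumberField Literature.NumberTheory.EllipticCurves
  Literature.NumberTheory.EllipticCurves.ModularForms
  Literature.NumberTheory.EllipticCurves.Rank1Residual
  Literature.NumberTheory.EllipticCurves.Rank1Residual.Typed
  IsDedekindDomain

namespace Summit.BirchSwinnertonDyer.Rank1Residual.Additive

variable (W : WeierstrassCurve ℚ) [W.IsElliptic] [W.IsGloballyMinimal] (p : ℕ) [hp : Fact p.Prime]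

/-! ### §1 The typed input and the certificate shape -/

/-- **The `ω^{(p−1)/2}`-branch cyclotomic main conjecture for the MULTIPLICATIVE twist, RATIONAL form,
TYPED, ODD case** (`p ≡ 3 (mod 4)`, `p = 3` included; twist by `−p`, minus branch of the one-term
measure `padicLFunctionMinusBranchMult`, `ϖ · |Ω⁻(V)| = Ω⁻_f`). OPEN — a predicate on `(W, p)`; nothing
asserted. [cite: BurungaleCastellaSkinner2025, Thm. 1.1.2 (a) (shape only; nothing asserted)]
[cite: MazurTateTeitelbaum1986Invent, §I.13 (shape only; nothing asserted)] -/
def ChiBranchRatCharEqMultOddAt (W : WeierstrassCurve ℚ) (p : ℕ) [Fact p.Prime] : Prop :=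
  ∀ (V : WeierstrassCurve ℚ) [V.IsElliptic] [V.IsGloballyMinimal]
    {κ : ZpExtension ℚ p} {γ : Field.absoluteGaloisGroup ℚ} {N : ℕ} [NeZero N]
    {f : CuspForm (Gamma0 N) 2},
    p % 4 = 3 →
    (∃ C : VariableChange ℚ, C • V.quadraticTwist (-(p : ℚ)) = W) →
    Mult V p →
    κ.IsCyclotomic → κ.IsTopGenerator γ → IsCyclotomicVariable p γ → IsNewformOf V f →
    ∀ (ap : ℤ), cuspCoeff f p = ap →
    ∀ (D : W.SelmerDualData κ γ) (ϖ : ℚ), (ϖ : ℝ) * V.imaginaryPeriodRat = minusPeriod f →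
      D.IsTorsion ∧
      ∃ (g : IwasawaAlgebra p) (k : ℤ), D.charIdeal = Ideal.span {g} ∧
        iwasawaToPowerSeries p g =
          PowerSeries.C ((p : ℚ_[p]) ^ k * (ϖ : ℚ_[p])) *
            padicLFunctionMinusBranchMult f (ap : ℚ_[p]) (p / 2)

/-- Unfolding lemma for `ChiBranchRatCharEqMultOddAt`. -/
theorem chiBranchRatCharEqMultOddAt_iff (W : WeierstrassCurve ℚ) (p : ℕ) [Fact p.Prime] :
    ChiBranchRatCharEqMultOddAt W p ↔
      ∀ (V : WeierstrassCurve ℚ) [V.IsElliptic] [V.IsGloballyMinimal]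
        {κ : ZpExtension ℚ p} {γ : Field.absoluteGaloisGroup ℚ} {N : ℕ} [NeZero N]
        {f : CuspForm (Gamma0 N) 2},
        p % 4 = 3 →
        (∃ C : VariableChange ℚ, C • V.quadraticTwist (-(p : ℚ)) = W) →
        Mult V p →
        κ.IsCyclotomic → κ.IsTopGenerator γ → IsCyclotomicVariable p γ → IsNewformOf V f →
        ∀ (ap : ℤ), cuspCoeff f p = ap →
        ∀ (D : W.SelmerDualData κ γ) (ϖ : ℚ), (ϖ : ℝ) * V.imaginaryPeriodRat = minusPeriod f →
          D.IsTorsion ∧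
          ∃ (g : IwasawaAlgebra p) (k : ℤ), D.charIdeal = Ideal.span {g} ∧
            iwasawaToPowerSeries p g =
              PowerSeries.C ((p : ℚ_[p]) ^ k * (ϖ : ℚ_[p])) *
                padicLFunctionMinusBranchMult f (ap : ℚ_[p]) (p / 2) :=
  Iff.rfl

/-- The certificate hypothesis of the (M) class forms, `p ≡ 3 (mod 4)` (twist by `−p`, minus branch,
`ϖ·|Ω⁻(V)| = Ω⁻_f`). -/
abbrev MultOddBranchUnitCoeffCert (W : WeierstrassCurve ℚ) (p : ℕ) [Fact p.Prime] : Prop :=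
  ∀ (V : WeierstrassCurve ℚ) [V.IsElliptic] [V.IsGloballyMinimal] (C : VariableChange ℚ),
    Mult V p → C • V.quadraticTwist (-(p : ℚ)) = W →
    ∀ {N : ℕ} [NeZero N] (f : CuspForm (Gamma0 N) 2), IsNewformOf V f → ∀ (ap : ℤ), cuspCoeff f p = ap →
    ∀ ϖ : ℚ, (ϖ : ℝ) * V.imaginaryPeriodRat = minusPeriod f →
    ∃ n : ℕ, ‖PowerSeries.coeff n
      (PowerSeries.C (ϖ : ℚ_[p]) * padicLFunctionMinusBranchMult f (ap : ℚ_[p]) (p / 2))‖ = 1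

/-! ### §2 The kernel step on (M), odd branch -/

/-- **(M), `p ≡ 3 (mod 4)` (`p = 3` included): rational ODD branch main conjecture of the multiplicative
twist + ONE unit coefficient ⟹ the LOWER divisibility at `T = 0`.** `W = C • V^{(−p)}`, `V`
MULTIPLICATIVE at `p`, newform `f`, `a_p(f) = ap ∈ {±1}`, `p ∣ N`, `ϖ·|Ω⁻(V)| = Ω⁻_f`;
`ChiBranchRatCharEqMultOddAt W p` and a unit coefficient of `ϖ · L_p⁻(f, ap, ω^{(p−1)/2}, T)` ⟹
`CycLowerLeadingTermAt W p`. Ingredients: `k ≥ 0` as above, `constantCoeff_padicLFunctionMinusBranchMult_half`,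
the odd Birch + Pal identity `entireLFunction_one_eq_of_twist_neg` (Pal `d < 0` PROVED, modularity
`hmod`), and the unit `|u(C)|·c_∞` (`padicValRat_u_eq_zero_of_twist_pm_p`).
[cite: MazurTateTeitelbaum1986Invent, §I.14] -/
theorem cycLowerLeadingTermAt_of_chiBranchRatCharEqMultOdd_of_unitCoeff
    (hmod : hasEntireLFunction_rat) (hp4 : p % 4 = 3) (hadd : Addv W p)
    (V : WeierstrassCurve ℚ) [V.IsElliptic] [V.IsGloballyMinimal]
    (C : VariableChange ℚ) (hC : C • V.quadraticTwist (-(p : ℚ)) = W) (hV : Mult V p)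
    {N : ℕ} [NeZero N] {f : CuspForm (Gamma0 N) 2} (hf : IsNewformOf V f) (hpN : p ∣ N)
    {ap : ℤ} (hap : cuspCoeff f p = ap) (hap1 : ap = 1 ∨ ap = -1)
    (ϖ : ℚ) (hϖ : (ϖ : ℝ) * V.imaginaryPeriodRat = minusPeriod f)
    (hMC : ChiBranchRatCharEqMultOddAt W p)
    (hcert : ∃ n : ℕ, ‖PowerSeries.coeff n
        (PowerSeries.C (ϖ : ℚ_[p]) * padicLFunctionMinusBranchMult f (ap : ℚ_[p]) (p / 2))‖ = 1) :
    CycLowerLeadingTermAt W p := by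
  have hpP : p.Prime := hp.out
  have hp2 : p ≠ 2 := by omega
  have hap0 : (ap : ℚ_[p]) ≠ 0 := by rcases hap1 with rfl | rfl <;> norm_num
  have hapinv : (ap : ℚ_[p])⁻¹ = (ap : ℚ_[p]) := by rcases hap1 with rfl | rfl <;> norm_num
  intro κ γ hκ hγ hγ' D f' hf'
  obtain ⟨-, g, k, hchar, hιg⟩ := hMC V hp4 ⟨C, hC⟩ hV hκ hγ hγ' hf ap hap D ϖ hϖ
  have hιg' : iwasawaToPowerSeries p g = PowerSeries.C ((p : ℚ_[p]) ^ k) *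
      (PowerSeries.C (ϖ : ℚ_[p]) * padicLFunctionMinusBranchMult f (ap : ℚ_[p]) (p / 2)) := by
    rw [hιg, map_mul, mul_assoc]
  have hk : 0 ≤ k := X9.exponent_nonneg_of_exists_norm_coeff_eq_one g _ k hιg' hcert
  obtain ⟨m, rfl⟩ : ∃ m : ℕ, k = m := ⟨k.toNat, (Int.toNat_of_nonneg hk).symm⟩
  have h0 := congrArg PowerSeries.constantCoeff hιg
  rw [constantCoeff_iwasawaToPowerSeries, map_mul, PowerSeries.constantCoeff_C,
    constantCoeff_padicLFunctionMinusBranchMult_half p hp2 hf.1 hf.coeffField_eq_bot hpN hap hap0,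
    zpow_natCast, hapinv, mul_assoc] at h0
  obtain ⟨ε, hε, hLq⟩ := entireLFunction_one_eq_of_twist_neg p hmod hp4 V W C hC hadd hf ϖ hϖ
  set S : ℚ := legendreMinusSymbolSum f p with hS
  set cinf : ℕ := (W.baseChange ℝ).numRealComponents with hcinf
  have hε0 : ε ≠ 0 := by rcases hε with rfl | rfl <;> norm_num
  have hεv : padicValRat p ε = 0 := by
    rcases hε with rfl | rfl
    · exact padicValRat.one
    · rw [padicValRat.neg]; exact padicValRat.one
  have hua0 : |(C.u : ℚ)| ≠ 0 := abs_ne_zero.mpr C.u.ne_zero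
  have hcinf0 : (cinf : ℚ) ≠ 0 := by
    rw [hcinf, numRealComponents]
    split_ifs <;> norm_num
  have hC'' : C • V.quadraticTwist (((-(p : ℤ)) : ℤ) : ℚ) = W := by push_cast; exact hC
  have hu : padicValRat p (C.u : ℚ) = 0 :=
    padicValRat_u_eq_zero_of_twist_pm_p p hp2 V W (Or.inr hV) (Or.inr rfl) C hC''
  have hvua : padicValRat p |(C.u : ℚ)| = 0 := by
    rcases abs_choice (C.u : ℚ) with h | h
    · rw [h]; exact hu
    · rw [h, padicValRat.neg]; exact hu
  have hd0 : ε * (|(C.u : ℚ)| * (cinf : ℚ)) ≠ 0 := mul_ne_zero hε0 (mul_ne_zero hua0 hcinf0)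
  have hdv : padicValRat p (ε * (|(C.u : ℚ)| * (cinf : ℚ))) = 0 := by
    rw [padicValRat.mul hε0 (mul_ne_zero hua0 hcinf0), padicValRat.mul hua0 hcinf0, hεv, hvua,
      hcinf, padicValRat_numRealComponents_eq_zero W p hp2]
    norm_num
  obtain ⟨w, hw⟩ := exists_units_coe_eq_ratCast p hd0 hdv
  have key : ϖ * S =
      (ε * (|(C.u : ℚ)| * (cinf : ℚ))) * (ε * (ϖ * S) / (|(C.u : ℚ)| * (cinf : ℚ))) := by
    have hε2Q : ε ^ 2 = 1 := by rcases hε with rfl | rfl <;> norm_num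
    have hdinv : (|(C.u : ℚ)| * (cinf : ℚ)) * (|(C.u : ℚ)| * (cinf : ℚ))⁻¹ = 1 :=
      mul_inv_cancel₀ (mul_ne_zero hua0 hcinf0)
    rw [div_eq_mul_inv]
    linear_combination (-(ϖ * S)) * hε2Q + (-(ϖ * S * ε ^ 2)) * hdinv
  have hq : ((w : ℤ_[p]) : ℚ_[p]) * (((ε * (ϖ * S) / (|(C.u : ℚ)| * (cinf : ℚ))) : ℚ) : ℚ_[p]) =
      (ϖ : ℚ_[p]) * (S : ℚ_[p]) := by
    rw [hw, ← Rat.cast_mul, ← key, Rat.cast_mul]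
  refine ⟨ε * (ϖ * S) / (|(C.u : ℚ)| * (cinf : ℚ)), hLq,
    exists_padicInt_constantCoeff_generator_of_pow_mul D hchar hf' h0 ((ap : ℤ_[p]) * (w : ℤ_[p])) ?_⟩
  rw [PadicInt.coe_mul, PadicInt.coe_intCast]
  linear_combination (-(ap : ℚ_[p])) * hq

/-! ### §3 Consequences on X4(M), `r_an = 0`, `p ≡ 3 (mod 4)` -/

variable {W p}

/-- **X4(M), `p ≡ 3 (mod 4)` (`p = 3` included): the integral lower divisibility at `T = 0` from the
rational ODD branch main conjecture of the multiplicative twist and the certificate.** Minus period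
ratio from `exists_rat_mul_imaginaryPeriodRat_eq_minusPeriod`. [cite: MazurTateTeitelbaum1986Invent, §I.14] -/
theorem _root_.Summit.BirchSwinnertonDyer.Rank1Residual.AdditivePotMult.ClassX4M.cycLowerLeadingTermAt_of_ratCharEqMultOdd_of_unitCoeff
    (hmod : hasEntireLFunction_rat) (hmodD : nonempty_modularParametrizationData)
    (hX : AdditivePotMult.ClassX4M W p) (hp4 : p % 4 = 3) (hMC : ChiBranchRatCharEqMultOddAt W p)
    (hcert : MultOddBranchUnitCoeffCert W p) : CycLowerLeadingTermAt W p := by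
  obtain ⟨V, iV, iVm, C, hV, hC⟩ := hX.exists_mult_pStar_twist_model
  haveI : NeZero (V.conductorNorm ℤ) := ⟨(V.conductorNorm_pos_holds).ne'⟩
  obtain ⟨Dm⟩ := hmodD V
  obtain ⟨ϖ, -, hϖ⟩ := exists_rat_mul_imaginaryPeriodRat_eq_minusPeriod Dm
  have hC' : C • V.quadraticTwist (-(p : ℚ)) = W := by
    rw [pStar_eq_of_mod_four p (Or.inr hp4), if_neg (by omega)] at hC
    exact hC
  by_cases hs : V.HasSplitMultiplicativeReductionAtPrime p
  · obtain ⟨hap, -⟩ := Dm.isNewformOf.cuspCoeff_eq_one_and_sq_of_split hs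
    have hap' : cuspCoeff Dm.f p = ((1 : ℤ) : ℂ) := by exact_mod_cast hap
    exact cycLowerLeadingTermAt_of_chiBranchRatCharEqMultOdd_of_unitCoeff W p hmod hp4 hX.1.2.1 V C hC'
      hV Dm.isNewformOf (Dm.isNewformOf.dvd_level_of_split hs) hap' (Or.inl rfl) ϖ hϖ hMC
      (hcert V C hV hC' Dm.f Dm.isNewformOf 1 hap' ϖ hϖ)
  · obtain ⟨hap, hpN⟩ := Dm.isNewformOf.cuspCoeff_eq_neg_one_and_dvd_of_nonsplit hV hs
    have hap' : cuspCoeff Dm.f p = ((-1 : ℤ) : ℂ) := by exact_mod_cast hap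
    exact cycLowerLeadingTermAt_of_chiBranchRatCharEqMultOdd_of_unitCoeff W p hmod hp4 hX.1.2.1 V C hC'
      hV Dm.isNewformOf hpN hap' (Or.inr rfl) ϖ hϖ hMC
      (hcert V C hV hC' Dm.f Dm.isNewformOf (-1) hap' ϖ hϖ)

/-- **X4(M), `r_an = 0`, `p ≡ 3 (mod 4)` (`p = 3` included): the LOWER half from the rational ODD branch
main conjecture of the multiplicative twist and the certificate.**
[cite: Delbourgo1998, Prop. 4 (p. 144), §2.2 Lemma (ii) (p. 139)] [cite: BurungaleCastellaSkinner2025, Thm. 1.1.2 (a) (shape only)] -/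
theorem _root_.Summit.BirchSwinnertonDyer.Rank1Residual.AdditivePotMult.ClassX4M.missingLowerBoundAt_rankZero_of_ratCharEqMultOdd_of_unitCoeff
    (hDelX : Delbourgo1998.prop4_rankZero_constantCoeff_eq_unit_mul_of_potMult)
    (hGZK : rank_eq_analyticRank_of_analyticRank_le_one) (hmod : hasEntireLFunction_rat)
    (hmodD : nonempty_modularParametrizationData)
    (hX : AdditivePotMult.ClassX4M W p) (hp4 : p % 4 = 3) (hr : W.analyticRank = 0)
    (hMC : ChiBranchRatCharEqMultOddAt W p) (hcert : MultOddBranchUnitCoeffCert W p) :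
    MissingLowerBoundAt W p :=
  AdditivePotMult.ClassX4M.missingLowerBoundAt_rankZero_of_cycLeadingTermDvd hDelX hGZK hmod hX hr
    (cycLeadingTermDvdAt_of_cycLowerLeadingTermAt
      (AdditivePotMult.ClassX4M.cycLowerLeadingTermAt_of_ratCharEqMultOdd_of_unitCoeff hmod hmodD hX hp4
        hMC hcert))

/-- **X4(M) ∧ surj(p), `r_an = 0`, `p ≡ 3 (mod 4)`: `BSD(E,p)` from the rational ODD branch main
conjecture of the multiplicative twist and the certificate** (upper half: additive-p1's
`ClassX4M.bsdp_rankZero_of_surj_of_lower`, any odd `p`). Nothing booked.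
[cite: Delbourgo1998, Prop. 4 (p. 144)] [cite: Kato2004Asterisque, Thm. 17.4 (3) (p. 273)] [cite: Miller2011LMS, Def. 1.1] -/
theorem _root_.Summit.BirchSwinnertonDyer.Rank1Residual.AdditivePotMult.ClassX4M.bsdp_rankZero_of_ratCharEqMultOdd_of_unitCoeff_of_surj
    (hDelX : Delbourgo1998.prop4_rankZero_constantCoeff_eq_unit_mul_of_potMult)
    (hDel : Delbourgo1998.prop4_rankZero_pow_dvd_constantCoeff)
    (hGZK : rank_eq_analyticRank_of_analyticRank_le_one) (hmod : hasEntireLFunction_rat)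
    (hmodD : nonempty_modularParametrizationData)
    (hL20 : Wuthrich2014.lemma20_surjective_threeAdic_of_semistable)
    (hKato : Wuthrich2014.kato_halfEigenCharIdeal_dvd_cyclotomicPrime_of_surjective)
    (hX : AdditivePotMult.ClassX4M W p) (hp4 : p % 4 = 3) (hr : W.analyticRank = 0) (hsurj : Surj W p)
    (hMC : ChiBranchRatCharEqMultOddAt W p) (hcert : MultOddBranchUnitCoeffCert W p) : BSDp W p :=
  AdditivePotMult.ClassX4M.bsdp_rankZero_of_surj_of_lower hDel hGZK hmod hmodD hL20 hKato hX hr hsurj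
    (AdditivePotMult.ClassX4M.missingLowerBoundAt_rankZero_of_ratCharEqMultOdd_of_unitCoeff hDelX hGZK
      hmod hmodD hX hp4 hr hMC hcert)

/-- **X4(M) ∧ surj(3), `r_an = 0`, at `p = 3` (the (M)@3 share of N11): `BSD(E,3)` from the rational ODD
branch main conjecture of the multiplicative twist and the certificate, TOWER-FREE** — upper half through
`ClassX4M.bsdp_three_rankZero_of_surj_of_lower'` (Kato's minus-eigen divisibility at `3`, `hKato3`;
n1011-p14's certificate-free `3`-adic tower). Nothing booked. [cite: Delbourgo1998, Prop. 4 (p. 144)]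
[cite: Kato2004Asterisque, Thm. 17.4 (3) (p. 273)] [cite: Miller2011LMS, Def. 1.1] -/
theorem _root_.Summit.BirchSwinnertonDyer.Rank1Residual.AdditivePotMult.ClassX4M.bsdp_three_rankZero_of_ratCharEqMultOdd_of_unitCoeff_of_surj
    (hDelX : Delbourgo1998.prop4_rankZero_constantCoeff_eq_unit_mul_of_potMult)
    (hDel : Delbourgo1998.prop4_rankZero_pow_dvd_constantCoeff)
    (hGZK : rank_eq_analyticRank_of_analyticRank_le_one) (hmod : hasEntireLFunction_rat)
    (hmodD : nonempty_modularParametrizationData)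
    (hKato3 : Wuthrich2014.kato_minusEigenCharIdeal_dvd_cyclotomicThree_of_surjective)
    (hX : AdditivePotMult.ClassX4M W 3) (hr : W.analyticRank = 0) (hsurj : Surj W 3)
    (hMC : ChiBranchRatCharEqMultOddAt W 3) (hcert : MultOddBranchUnitCoeffCert W 3) : BSDp W 3 :=
  haveI : Fact (Nat.Prime 3) := ⟨Nat.prime_three⟩
  AdditivePotMult.ClassX4M.bsdp_three_rankZero_of_surj_of_lower' hDel hGZK hmod hmodD hKato3 hX hr hsurj
    (AdditivePotMult.ClassX4M.missingLowerBoundAt_rankZero_of_ratCharEqMultOdd_of_unitCoeff hDelX hGZK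
      hmod hmodD hX (by norm_num) hr hMC hcert)

end Summit.BirchSwinnertonDyer.Rank1Residual.Additive

end
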